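import Summits.Ventures.Crystal3D.Theorems.StickyWulffConstantNoReconstructionGainCubeNoGain
import HarnessLib

/-!
# The cube frame of the model fcc lattice and the covering radius `1/√2` of its square layers

HONEST FRAMING. Part of the venture `Summits/Ventures/Crystal3D` (cell `crystal3d-full`), helper
`--supports` the crux `NoReconstructionGain` (stmt-Ventures-19144, route
`route-Ventures-StickyWulffConstant`).  Elementary geometry of `Λ₀ = fccStacking 1 √(2/3)` seen
along the cube normal `ν₁₀₀ = (√2/2, √6/6, −√3/3)` (`FccCubeFacetNoGain.lean`): with
`e₁' = (1/2, −√3/2, 0)`, `e₂' = (1/2, √3/6, √6/3)` the triple `(e₁', e₂', ν₁₀₀)` is an orthonormal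
frame in which the site `barlowPos k i j` has coordinates `((i − j)/2, k + (i + j)/2, (i + j)/√2)`;
so the `(100)` layer `i + j = s` is the unit SQUARE lattice `(ℤ − s/2) × (ℤ + s/2)` at height
`s/√2`.

* `inner_barlowPos_cubeFrame₁/₂` — the frame coordinates of the sites; `norm_sq_eq_cubeFrame` —
  `‖v‖² = ⟪v,e₁'⟫² + ⟪v,e₂'⟫² + ⟪v,ν₁₀₀⟫²` (orthonormality, by coordinates).
* `exists_cubeSite_planar_sq_le_half` — COVERING: every point is within planar distance `1/√2`
  (squared `≤ 1/2`) of a site of every `(100)` layer `s`.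
* `cube_hollow_height_sq` — a point at distance `≥ 1` from its covering site of layer `s` is at
  height-distance `≥ 1/√2` from the layer (`(Δη)² ≥ 1 − 1/2`): the hollow sites of a square
  layer are the lowest admissible positions, at height `1/√2` = the `(100)` layer spacing.

WHAT THIS IS NOT: nothing about the crux by itself; rung F-C1 not moved.
-/

noncomputable section

namespace Summit.Ventures.Crystal3D.Theorems

open Real
open Literature.MathematicalPhysics.StatisticalMechanics (barlowPos constHagg haggLabel_const
  barlowPos_apply_zero barlowPos_apply_one barlowPos_apply_two)
open scoped InnerProductSpace

/-- First cube-frame coordinate of a site: `⟪barlowPos k i j, (1/2, −√3/2, 0)⟫ = (i − j)/2`. -/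
theorem inner_barlowPos_cubeFrame₁ (k i j : ℤ) :
    ⟪barlowPos 1 (Real.sqrt (2 / 3)) constHagg k i j,
      (!₂[1 / 2, -(Real.sqrt 3 / 2), 0] : EuclideanSpace ℝ (Fin 3))⟫_ℝ = ((i : ℝ) - j) / 2 := by
  have h33 : Real.sqrt 3 * Real.sqrt 3 = 3 := Real.mul_self_sqrt (by norm_num)
  rw [EuclideanSpace.inner_eq_star_dotProduct]
  simp [dotProduct, Fin.sum_univ_three, barlowPos_apply_zero, barlowPos_apply_one,
    barlowPos_apply_two]
  have e1 : ∀ X : ℝ, Real.sqrt 3 / 2 * (Real.sqrt 3 / 2 * X) = 3 * X / 4 := fun X => by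
    rw [show Real.sqrt 3 / 2 * (Real.sqrt 3 / 2 * X) = Real.sqrt 3 * Real.sqrt 3 / 4 * X by ring,
      h33]; ring
  rw [e1]; ring

/-- Second cube-frame coordinate: `⟪barlowPos k i j, (1/2, √3/6, √6/3)⟫ = k + (i + j)/2`. -/
theorem inner_barlowPos_cubeFrame₂ (k i j : ℤ) :
    ⟪barlowPos 1 (Real.sqrt (2 / 3)) constHagg k i j,
      (!₂[1 / 2, Real.sqrt 3 / 6, Real.sqrt 6 / 3] : EuclideanSpace ℝ (Fin 3))⟫_ℝ =
      (k : ℝ) + ((i : ℝ) + j) / 2 := by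
  have h33 : Real.sqrt 3 * Real.sqrt 3 = 3 := Real.mul_self_sqrt (by norm_num)
  have h22 : Real.sqrt 2 * Real.sqrt 2 = 2 := Real.mul_self_sqrt (by norm_num)
  have h6 : Real.sqrt 6 = Real.sqrt 2 * Real.sqrt 3 := by
    rw [← Real.sqrt_mul (by norm_num)]; norm_num
  have h3pos : 0 < Real.sqrt 3 := Real.sqrt_pos.2 (by norm_num)
  rw [EuclideanSpace.inner_eq_star_dotProduct]
  simp [dotProduct, Fin.sum_univ_three, barlowPos_apply_zero, barlowPos_apply_one,
    barlowPos_apply_two]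
  rw [h6]
  have e1 : ∀ X : ℝ, Real.sqrt 3 / 6 * (Real.sqrt 3 / 2 * X) = X / 4 := fun X => by
    rw [show Real.sqrt 3 / 6 * (Real.sqrt 3 / 2 * X) = Real.sqrt 3 * Real.sqrt 3 / 12 * X by ring,
      h33]; ring
  have e2 : Real.sqrt 2 * Real.sqrt 3 / 3 * ((k : ℝ) * (Real.sqrt 2 / Real.sqrt 3)) = 2 * k / 3 := by
    rw [show Real.sqrt 2 * Real.sqrt 3 / 3 * ((k : ℝ) * (Real.sqrt 2 / Real.sqrt 3)) =
      Real.sqrt 2 * Real.sqrt 2 * k / 3 * (Real.sqrt 3 / Real.sqrt 3) by ring, h22,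
      div_self h3pos.ne', mul_one]
  rw [e1, e2]; ring

/-- **Orthonormality of the cube frame, in the form used**: for every `v`,
`‖v‖² = ⟪v, e₁'⟫² + ⟪v, e₂'⟫² + ⟪v, ν₁₀₀⟫²`. -/
theorem norm_sq_eq_cubeFrame (v : EuclideanSpace ℝ (Fin 3)) :
    ‖v‖ ^ 2 = ⟪v, (!₂[1 / 2, -(Real.sqrt 3 / 2), 0] : EuclideanSpace ℝ (Fin 3))⟫_ℝ ^ 2 +
      ⟪v, (!₂[1 / 2, Real.sqrt 3 / 6, Real.sqrt 6 / 3] : EuclideanSpace ℝ (Fin 3))⟫_ℝ ^ 2 +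
      ⟪v, (!₂[Real.sqrt 2 / 2, Real.sqrt 6 / 6, -(Real.sqrt 3 / 3)] : EuclideanSpace ℝ (Fin 3))⟫_ℝ ^ 2 := by
  have h2 : Real.sqrt 2 ^ 2 = 2 := Real.sq_sqrt (by norm_num)
  have h3 : Real.sqrt 3 ^ 2 = 3 := Real.sq_sqrt (by norm_num)
  have h6 : Real.sqrt 6 ^ 2 = 6 := Real.sq_sqrt (by norm_num)
  have h26 : Real.sqrt 2 * Real.sqrt 6 = 2 * Real.sqrt 3 := by
    rw [← Real.sqrt_mul (by norm_num), show (2 : ℝ) * 6 = 2 ^ 2 * 3 by norm_num,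
      Real.sqrt_mul (by norm_num), Real.sqrt_sq (by norm_num)]
  have h36 : Real.sqrt 3 * Real.sqrt 6 = 3 * Real.sqrt 2 := by
    rw [← Real.sqrt_mul (by norm_num), show (3 : ℝ) * 6 = 3 ^ 2 * 2 by norm_num,
      Real.sqrt_mul (by norm_num), Real.sqrt_sq (by norm_num)]
  have h23' : Real.sqrt 2 * Real.sqrt 3 = Real.sqrt 6 := by
    rw [← Real.sqrt_mul (by norm_num)]; norm_num
  rw [EuclideanSpace.real_norm_sq_eq, Fin.sum_univ_three, EuclideanSpace.inner_eq_star_dotProduct,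
    EuclideanSpace.inner_eq_star_dotProduct, EuclideanSpace.inner_eq_star_dotProduct]
  simp [dotProduct, Fin.sum_univ_three]
  linear_combination (-(v 0) ^ 2 / 4) * h2 + (-(10 / 36) * (v 1) ^ 2 - (v 2) ^ 2 / 9) * h3 +
    (-(v 1) ^ 2 / 36 - (v 2) ^ 2 / 9) * h6 + (-(v 0 * v 1) / 6) * h26 + (v 0 * v 2 / 3) * h23'

/-- **Covering radius `1/√2` of every `(100)` layer.**  For every point `y` and every layer index
`s` there are `k, i` with `i + j = s` (`j = s − i`) such that the site `barlowPos k i (s − i)` is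
within planar squared distance `1/2` of `y` in the cube frame. -/
theorem exists_cubeSite_planar_sq_le_half (y : EuclideanSpace ℝ (Fin 3)) (s : ℤ) :
    ∃ k i : ℤ,
      (⟪y, (!₂[1 / 2, -(Real.sqrt 3 / 2), 0] : EuclideanSpace ℝ (Fin 3))⟫_ℝ -
          ⟪barlowPos 1 (Real.sqrt (2 / 3)) constHagg k i (s - i),
            (!₂[1 / 2, -(Real.sqrt 3 / 2), 0] : EuclideanSpace ℝ (Fin 3))⟫_ℝ) ^ 2 +
        (⟪y, (!₂[1 / 2, Real.sqrt 3 / 6, Real.sqrt 6 / 3] : EuclideanSpace ℝ (Fin 3))⟫_ℝ -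
          ⟪barlowPos 1 (Real.sqrt (2 / 3)) constHagg k i (s - i),
            (!₂[1 / 2, Real.sqrt 3 / 6, Real.sqrt 6 / 3] : EuclideanSpace ℝ (Fin 3))⟫_ℝ) ^ 2
        ≤ 1 / 2 := by
  set a : ℝ := ⟪y, (!₂[1 / 2, -(Real.sqrt 3 / 2), 0] : EuclideanSpace ℝ (Fin 3))⟫_ℝ with ha
  set b : ℝ := ⟪y, (!₂[1 / 2, Real.sqrt 3 / 6, Real.sqrt 6 / 3] : EuclideanSpace ℝ (Fin 3))⟫_ℝ
    with hb
  set i : ℤ := ⌊a + (s : ℝ) / 2 + 1 / 2⌋ with hi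
  set k : ℤ := ⌊b - (s : ℝ) / 2 + 1 / 2⌋ with hk
  refine ⟨k, i, ?_⟩
  rw [inner_barlowPos_cubeFrame₁, inner_barlowPos_cubeFrame₂]
  push_cast
  have hi1 : (i : ℝ) ≤ a + (s : ℝ) / 2 + 1 / 2 := Int.floor_le _
  have hi2 : a + (s : ℝ) / 2 + 1 / 2 < (i : ℝ) + 1 := Int.lt_floor_add_one _
  have hk1 : (k : ℝ) ≤ b - (s : ℝ) / 2 + 1 / 2 := Int.floor_le _
  have hk2 : b - (s : ℝ) / 2 + 1 / 2 < (k : ℝ) + 1 := Int.lt_floor_add_one _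
  have e1 : a - ((i : ℝ) - ((s : ℝ) - i)) / 2 = a + (s : ℝ) / 2 - i := by ring
  have e2 : b - ((k : ℝ) + ((i : ℝ) + ((s : ℝ) - i)) / 2) = b - (s : ℝ) / 2 - k := by ring
  rw [e1, e2]
  nlinarith [sq_nonneg (a + (s : ℝ) / 2 - i - 1 / 2 + 1 / 2)]

/-- **Hollow-site inequality for square layers.**  If `y` is at distance `≥ 1` from a site `p` of
layer `s` within planar squared distance `1/2`, then `(⟪y, ν₁₀₀⟫ − s/√2)² ≥ 1/2`. -/
theorem cube_hollow_height_sq (y : EuclideanSpace ℝ (Fin 3)) (s k i : ℤ)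
    (hplanar : (⟪y, (!₂[1 / 2, -(Real.sqrt 3 / 2), 0] : EuclideanSpace ℝ (Fin 3))⟫_ℝ -
          ⟪barlowPos 1 (Real.sqrt (2 / 3)) constHagg k i (s - i),
            (!₂[1 / 2, -(Real.sqrt 3 / 2), 0] : EuclideanSpace ℝ (Fin 3))⟫_ℝ) ^ 2 +
        (⟪y, (!₂[1 / 2, Real.sqrt 3 / 6, Real.sqrt 6 / 3] : EuclideanSpace ℝ (Fin 3))⟫_ℝ -
          ⟪barlowPos 1 (Real.sqrt (2 / 3)) constHagg k i (s - i),
            (!₂[1 / 2, Real.sqrt 3 / 6, Real.sqrt 6 / 3] : EuclideanSpace ℝ (Fin 3))⟫_ℝ) ^ 2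
        ≤ 1 / 2)
    (hfar : 1 ≤ dist y (barlowPos 1 (Real.sqrt (2 / 3)) constHagg k i (s - i))) :
    1 / 2 ≤ (⟪y, (!₂[Real.sqrt 2 / 2, Real.sqrt 6 / 6, -(Real.sqrt 3 / 3)] : EuclideanSpace ℝ (Fin 3))⟫_ℝ
      - (s : ℝ) * (Real.sqrt 2 / 2)) ^ 2 := by
  set p := barlowPos 1 (Real.sqrt (2 / 3)) constHagg k i (s - i) with hp
  have hη : ⟪p, (!₂[Real.sqrt 2 / 2, Real.sqrt 6 / 6, -(Real.sqrt 3 / 3)] : EuclideanSpace ℝ (Fin 3))⟫_ℝ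
      = (s : ℝ) * (Real.sqrt 2 / 2) := by
    rw [hp, inner_barlowPos_cubeNormal]; push_cast; ring
  have hd : dist y p ^ 2 = ‖y - p‖ ^ 2 := by rw [dist_eq_norm]
  rw [norm_sq_eq_cubeFrame (y - p), inner_sub_left, inner_sub_left, inner_sub_left, hη] at hd
  have h1 : 1 ≤ dist y p ^ 2 := by nlinarith
  linarith

end Summit.Ventures.Crystal3D.Theorems

end
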